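import Summits.AtomisticToContinuum.FouriersLaw.Theorems.OddSectorIrreversibilityOddDensityIsCorrectorDetailedBalance

/-!
# `OddDensityIsCorrector`, part 9: coboundaries — `R_λ(LΨ) = λR_λΨ - Ψ` for smooth nice `Ψ`

Helper file for support item `stmt-AtomisticToContinuum-9146`
(`OddSectorIrreversibility.OddDensityIsCorrector`).

Dynkin's identity for NON-compactly supported smooth observables of the equilibrium pinned chain, in
resolvent form and without any stochastic calculus: if `Ψ ∈ C²` and both `Ψ` and `LΨ` are nice
(continuous, `|·| ≤ C e^{ϑH}`, `0 < ϑ`, `2ϑ < 1/T`), then for every `λ > 0`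

  `R_λ(LΨ) = λ R_λ Ψ - Ψ`   `μ_T`-a.e.    (`pinnedChain_resolvent_coboundary`).

Proof: both sides are weak solutions `W` of `(λ - L) W = LΨ` in the sense
`∫ (λG - L†G) W dμ_T = ∫ G · LΨ dμ_T` for all test functions `G` (`L†G = (L(G∘Θ))∘Θ`): the left side
by `R_λ* (λ - L†) G = G` (`pinnedChain_resolvent_adjoint_test`), the right side by the same identity
and `∫ (L†G) Ψ dμ_T = ∫ G (LΨ) dμ_T` (generator-level detailed balance
`pinnedChain_integral_generator_mul_gibbsMeasure_eq_reversal` and `Θ`-invariance of `μ_T`); weak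
solutions are unique (`ae_eq_zero_of_weak_resolvent_adjoint`: the density of `Θ(λ - L)C_c^∞`).
Consequences: `∫ R_λ f dμ_T = μ_T(f)/λ` (`pinnedChain_integral_resolvent_gibbsMeasure`, Fubini and
invariance) gives `μ_T(LΨ) = 0` (`pinnedChain_integral_generator_gibbsMeasure_eq_zero`).
Nothing here closes an item.
-/

noncomputable section

open MeasureTheory ProbabilityTheory Filter Topology Set Function
open scoped ContDiff NNReal ENNReal
open Literature.MathematicalPhysics.KineticTheory.HeatConduction
open Summit.AtomisticToContinuum.FouriersLaw.Theorems.SubdiffusiveBondHeat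

namespace Summit.AtomisticToContinuum.FouriersLaw.Theorems.OddSectorIrreversibility

variable {N : ℕ}

section Pinned

variable {ω₂ lam β γ : ℝ} (hω : 0 < ω₂) (hl : 0 ≤ lam) (hβ : 0 < β) (hγ : 0 < γ) (hN : 2 ≤ N)
  {T : ℝ} (hT : 0 < T)
include hω hl hβ hγ hN hT

/-! ### `∫ R_λ f dμ_T = μ_T(f)/λ` -/

/-- **The resolvent preserves means up to `1/λ`**: `∫ R_λ f dμ_T = λ⁻¹ ∫ f dμ_T` for nice `f`, `λ > 0`
(Fubini and the invariance of `μ_T` under the kernels). [folklore] -/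
theorem pinnedChain_integral_resolvent_gibbsMeasure {ϑ : ℝ} (hϑ0 : 0 < ϑ) (h2ϑ : 2 * ϑ < 1 / T)
    {f : PhaseSpace N → ℝ} (hf : Continuous f) {C : ℝ} (hC : 0 ≤ C)
    (hfb : ∀ y, |f y| ≤ C * Real.exp (ϑ * (pinnedChain ω₂ lam β γ).hamiltonian N y))
    {lam' : ℝ} (hlam : 0 < lam') :
    ∫ z, (∫ t in Ioi (0 : ℝ), Real.exp (-(lam' * t)) *
        ∫ y, f y ∂((pinnedChain ω₂ lam β γ).transitionKernel N T T t.toNNReal z))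
        ∂((pinnedChain ω₂ lam β γ).gibbsMeasure N T) =
      lam'⁻¹ * ∫ z, f z ∂((pinnedChain ω₂ lam β γ).gibbsMeasure N T) := by
  have hN0 : 0 < N := by omega
  have hϑ1 : ϑ < 1 / T := by linarith
  obtain ⟨K, c, -, hc, hb⟩ := pinnedChain_harris_bound hω hl hβ hγ hN0 hT hϑ0 hϑ1
  set P := pinnedChain ω₂ lam β γ with hP
  set π := P.gibbsMeasure N T with hπ
  haveI : IsProbabilityMeasure π := pinnedChain_isProbabilityMeasure_gibbsMeasure hω hl hβ.le γ N hT
  set act : ℝ → PhaseSpace N → ℝ := fun t z => ∫ y, f y ∂(P.transitionKernel N T T t.toNNReal z) with hact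
  set w : ℝ → ℝ := fun t => Real.exp (-(lam' * t)) with hw
  set m := ∫ y, f y ∂π with hm
  have hjm : StronglyMeasurable fun q : PhaseSpace N × ℝ => w q.2 * act q.2 q.1 := by
    have h1 := (pinnedChain_stronglyMeasurable_act_uncurry hω hl hβ.le hγ.le T T hf.measurable).comp_measurable
      (measurable_swap : Measurable fun q : PhaseSpace N × ℝ => q.swap)
    have hwc : Continuous fun q : PhaseSpace N × ℝ => w q.2 :=
      Real.continuous_exp.comp (continuous_const.mul continuous_snd).neg
    exact hwc.stronglyMeasurable.mul h1
  have hbound : ∀ z t, ‖w t * act t z‖ ≤ Real.exp (ϑ * P.hamiltonian N z) * ((|m| + K * C) * w t) := by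
    intro z t
    have hu := pinnedChain_abs_act_le hω hl hβ hϑ0 hb hc hf hC hfb z t.toNNReal
    rw [norm_mul, Real.norm_eq_abs, Real.norm_eq_abs, abs_of_pos (Real.exp_pos _)]
    calc w t * |act t z| ≤ w t * ((|m| + K * C) * Real.exp (ϑ * P.hamiltonian N z)) :=
          mul_le_mul_of_nonneg_left hu (Real.exp_pos _).le
      _ = Real.exp (ϑ * P.hamiltonian N z) * ((|m| + K * C) * w t) := by ring
  have hwi : Integrable w (volume.restrict (Ioi (0 : ℝ))) := by
    have := exp_neg_integrableOn_Ioi 0 hlam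
    refine this.congr (Eventually.of_forall fun t => ?_); simp [hw, neg_mul]
  have hE : Integrable (fun z => Real.exp (ϑ * P.hamiltonian N z)) π :=
    pinnedChain_integrable_exp_mul_hamiltonian_gibbsMeasure hω hl hβ.le γ N hT hϑ1
  have hprod : Integrable (fun q : PhaseSpace N × ℝ => w q.2 * act q.2 q.1) (π.prod (volume.restrict (Ioi (0 : ℝ)))) := by
    refine Integrable.mono' (hE.mul_prod (hwi.const_mul (|m| + K * C))) hjm.aestronglyMeasurable ?_
    exact Eventually.of_forall fun q => hbound q.1 q.2
  have hswap : ∫ z, (∫ t in Ioi (0 : ℝ), w t * act t z) ∂π = ∫ t in Ioi (0 : ℝ), (∫ z, w t * act t z ∂π) :=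
    integral_integral_swap hprod
  have hinv : ∀ t : ℝ, ∫ z, w t * act t z ∂π = w t * m := by
    intro t
    rw [integral_const_mul]
    congr 1
    exact pinnedChain_integral_transitionKernel_gibbsMeasure hω hl hβ.le hγ.le hN0 hT t.toNNReal
      (integrable_of_abs_le_exp (pinnedChain_integrable_exp_mul_hamiltonian_gibbsMeasure hω hl hβ.le γ N hT hϑ1) hf hfb)
  rw [hswap, integral_congr_ae (Eventually.of_forall hinv : (fun t => ∫ z, w t * act t z ∂π) =ᵐ[volume.restrict (Ioi 0)]
    fun t => w t * m), integral_mul_const, integral_exp_neg_mul_Ioi hlam]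
  ring

/-! ### Uniqueness of weak solutions of `(λ - L) W = B` -/

/-- **Weak solutions tested against `(λ - L†)C_c^∞` are unique**: if `k ∈ L²(μ_T)` is measurable and
`∫ (λG - (L(G∘Θ))∘Θ) k dμ_T = 0` for all test functions `G` (`λ > 0`), then `k = 0` a.e.
(`Θ`-conjugation of `ae_eq_zero_of_weak_resolvent`: `k∘Θ ⊥ (λ - L)C_c^∞`). [folklore] -/
theorem ae_eq_zero_of_weak_resolvent_adjoint {lam' : ℝ} (hlam : 0 < lam') {k : PhaseSpace N → ℝ}
    (hkm : Measurable k) (hk : MemLp k 2 ((pinnedChain ω₂ lam β γ).gibbsMeasure N T))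
    (hweak : ∀ G : PhaseSpace N → ℝ, ContDiff ℝ ∞ G → HasCompactSupport G →
      ∫ z, (lam' * G z - (pinnedChain ω₂ lam β γ).generator N T T (fun y : PhaseSpace N => G (y.1, -y.2)) (z.1, -z.2)) *
        k z ∂((pinnedChain ω₂ lam β γ).gibbsMeasure N T) = 0) :
    k =ᵐ[(pinnedChain ω₂ lam β γ).gibbsMeasure N T] 0 := by
  set P := pinnedChain ω₂ lam β γ with hP
  set π := P.gibbsMeasure N T with hπ
  have hΘs : ContDiff ℝ ∞ (fun y : PhaseSpace N => ((y.1, -y.2) : PhaseSpace N)) := contDiff_fst.prodMk contDiff_snd.neg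
  have hΘm : Measurable (fun y : PhaseSpace N => ((y.1, -y.2) : PhaseSpace N)) := measurable_fst.prodMk measurable_snd.neg
  set Θh : PhaseSpace N ≃ₜ PhaseSpace N := (Homeomorph.refl (Fin N → ℝ)).prodCongr (Homeomorph.neg (Fin N → ℝ)) with hΘh
  -- `Θ` preserves `μ_T`
  have hmp : MeasurePreserving (momentumReversal N) π π := measurePreserving_reversal_gibbsMeasure P N T
  -- `k∘Θ` is orthogonal to `(λ - L)C_c^∞`
  set kΘ : PhaseSpace N → ℝ := fun y => k (y.1, -y.2) with hkΘ
  have hkΘm : Measurable kΘ := hkm.comp hΘm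
  have hkΘL : MemLp kΘ 2 π := by
    have := hk.comp_measurePreserving hmp
    simpa [hkΘ, Function.comp_def, momentumReversal_apply] using this
  have hweak' : ∀ F : PhaseSpace N → ℝ, ContDiff ℝ ∞ F → HasCompactSupport F →
      ∫ z, (lam' * F z - P.generator N T T F z) * kΘ z ∂π = 0 := by
    intro F hF hFc
    have hG : ContDiff ℝ ∞ (fun y : PhaseSpace N => F (y.1, -y.2)) := hF.comp hΘs
    have hGc : HasCompactSupport (fun y : PhaseSpace N => F (y.1, -y.2)) := hFc.comp_homeomorph Θh
    have h := hweak _ hG hGc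
    have hGG : (fun y : PhaseSpace N => (fun w : PhaseSpace N => F (w.1, -w.2)) (y.1, -y.2)) = F := by
      funext y; simp
    rw [hGG] at h
    -- `∫ (λF(Θz) - (LF)(Θz)) k(z) dπ = ∫ (λF - LF)(z) k(Θz) dπ`
    have := integral_comp_reversal_gibbsMeasure P N T (fun z => (lam' * F z - P.generator N T T F z) * kΘ z)
    simp only [hkΘ, neg_neg, Prod.mk.eta] at this
    rw [← this]
    simpa using h
  have h0 := ae_eq_zero_of_weak_resolvent hω hl hβ.le hγ hN hT hlam hkΘm hkΘL hweak'
  -- pull back through `Θ`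
  have h1 := hmp.quasiMeasurePreserving.ae_eq_comp h0
  filter_upwards [h1] with z hz
  simpa [hkΘ, Function.comp_def, momentumReversal_apply] using hz

/-! ### The coboundary lemma -/

omit hω hl hβ hγ hN in
/-- `∫ (L†G) Ψ dμ_T = ∫ G (LΨ) dμ_T` for a test function `G` and `Ψ ∈ C²` (`L†G = (L(G∘Θ))∘Θ`; the
adjoint identity `pinnedChain_integral_generator_mul_gibbsMeasure_eq_reversal` read through the
`Θ`-invariance of `μ_T`). [cite: KunduDharNarayan2009, eq. (reln2)] -/
theorem pinnedChain_integral_adjGenerator_mul {G Ψ : PhaseSpace N → ℝ} (hG : ContDiff ℝ ∞ G)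
    (hGc : HasCompactSupport G) (hΨ : ContDiff ℝ 2 Ψ) :
    ∫ z, (pinnedChain ω₂ lam β γ).generator N T T (fun y : PhaseSpace N => G (y.1, -y.2)) (z.1, -z.2) * Ψ z
        ∂((pinnedChain ω₂ lam β γ).gibbsMeasure N T) =
      ∫ z, G z * (pinnedChain ω₂ lam β γ).generator N T T Ψ z ∂((pinnedChain ω₂ lam β γ).gibbsMeasure N T) := by
  set P := pinnedChain ω₂ lam β γ with hP
  have hΘs : ContDiff ℝ ∞ (fun y : PhaseSpace N => ((y.1, -y.2) : PhaseSpace N)) := contDiff_fst.prodMk contDiff_snd.neg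
  set Θh : PhaseSpace N ≃ₜ PhaseSpace N := (Homeomorph.refl (Fin N → ℝ)).prodCongr (Homeomorph.neg (Fin N → ℝ)) with hΘh
  have hG' : ContDiff ℝ 2 (fun y : PhaseSpace N => G (y.1, -y.2)) := (hG.comp hΘs).of_le (by norm_cast)
  have hG'c : HasCompactSupport (fun y : PhaseSpace N => G (y.1, -y.2)) := hGc.comp_homeomorph Θh
  have hΨ' : ContDiff ℝ 2 (fun y : PhaseSpace N => Ψ (y.1, -y.2)) := hΨ.comp (hΘs.of_le (by norm_cast))
  -- `∫ (L G')(Θx) Ψ(x) = ∫ (L G')(x) Ψ(Θx)` with `G' = G∘Θ`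
  have e1 := integral_comp_reversal_gibbsMeasure P N T
    (fun z => P.generator N T T (fun y : PhaseSpace N => G (y.1, -y.2)) z * Ψ (z.1, -z.2))
  simp only [neg_neg, Prod.mk.eta] at e1
  rw [e1]
  -- adjoint identity with the test function `G'` and `k = Ψ∘Θ`
  rw [pinnedChain_integral_generator_mul_gibbsMeasure_eq_reversal ω₂ lam β γ N hT.ne' hG' hG'c hΨ']
  -- `(Ψ∘Θ)∘Θ = Ψ`, then `Θ`-invariance once more
  have hΨΨ : (fun y : PhaseSpace N => (fun w : PhaseSpace N => Ψ (w.1, -w.2)) (y.1, -y.2)) = Ψ := by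
    funext y; simp
  rw [hΨΨ]
  have e2 := integral_comp_reversal_gibbsMeasure P N T (fun z => G z * P.generator N T T Ψ z)
  exact e2

/-- **The coboundary lemma.** For `Ψ ∈ C²` with `Ψ` and `LΨ` nice (`0 < ϑ`, `2ϑ < 1/T`) and `λ > 0`:
`R_λ(LΨ) = λ R_λ Ψ - Ψ`, `μ_T`-a.e. — both sides are weak solutions of `(λ - L)W = LΨ` against
`(λ - L†)C_c^∞` (`pinnedChain_resolvent_adjoint_test`, `pinnedChain_integral_adjGenerator_mul`), and
such weak solutions are unique (`ae_eq_zero_of_weak_resolvent_adjoint`).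
[cite: KunduDharNarayan2009, eq. (reln3)] -/
theorem pinnedChain_resolvent_coboundary {ϑ : ℝ} (hϑ0 : 0 < ϑ) (h2ϑ : 2 * ϑ < 1 / T)
    {Ψ : PhaseSpace N → ℝ} (hΨ : ContDiff ℝ 2 Ψ) {CΨ CL : ℝ} (hCΨ : 0 ≤ CΨ) (hCL : 0 ≤ CL)
    (hΨb : ∀ y, |Ψ y| ≤ CΨ * Real.exp (ϑ * (pinnedChain ω₂ lam β γ).hamiltonian N y))
    (hLb : ∀ y, |(pinnedChain ω₂ lam β γ).generator N T T Ψ y| ≤ CL * Real.exp (ϑ * (pinnedChain ω₂ lam β γ).hamiltonian N y))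
    {lam' : ℝ} (hlam : 0 < lam') :
    (fun z => ∫ t in Ioi (0 : ℝ), Real.exp (-(lam' * t)) *
        ∫ y, (pinnedChain ω₂ lam β γ).generator N T T Ψ y ∂((pinnedChain ω₂ lam β γ).transitionKernel N T T t.toNNReal z))
      =ᵐ[(pinnedChain ω₂ lam β γ).gibbsMeasure N T]
    fun z => lam' * (∫ t in Ioi (0 : ℝ), Real.exp (-(lam' * t)) *
        ∫ y, Ψ y ∂((pinnedChain ω₂ lam β γ).transitionKernel N T T t.toNNReal z)) - Ψ z := by
  set P := pinnedChain ω₂ lam β γ with hP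
  set π := P.gibbsMeasure N T with hπ
  have hN0 : 0 < N := by omega
  have hϑ1 : ϑ < 1 / T := by linarith
  haveI : IsProbabilityMeasure π := pinnedChain_isProbabilityMeasure_gibbsMeasure hω hl hβ.le γ N hT
  have hU1 : ContDiff ℝ 1 P.U := pinnedChain_contDiff_U ω₂ lam β γ
  have hV1 : ContDiff ℝ 1 P.V := pinnedChain_contDiff_V ω₂ lam β γ
  set LΨ := P.generator N T T Ψ with hLΨ
  have hLc : Continuous LΨ := P.continuous_generator hU1 hV1 N T T hΨ
  have hΨc : Continuous Ψ := hΨ.continuous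
  set R : (PhaseSpace N → ℝ) → PhaseSpace N → ℝ := fun f z => ∫ t in Ioi (0 : ℝ), Real.exp (-(lam' * t)) *
    ∫ y, f y ∂(P.transitionKernel N T T t.toNNReal z) with hR
  -- the difference `V = R(LΨ) - (λ RΨ - Ψ)` is in `L²` and measurable
  have hRL := pinnedChain_integral_sq_resolvent_le hω hl hβ hγ hN0 hT hϑ0 h2ϑ hLc hCL hLb hlam
  have hRΨ := pinnedChain_integral_sq_resolvent_le hω hl hβ hγ hN0 hT hϑ0 h2ϑ hΨc hCΨ hΨb hlam
  have hΨ2 : Integrable (fun z => Ψ z ^ 2) π := (pinnedChain_integral_sq_act_le hω hl hβ hγ hN0 hT hϑ0 h2ϑ hΨc hΨb 0).1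
  have hL2 : Integrable (fun z => LΨ z ^ 2) π := (pinnedChain_integral_sq_act_le hω hl hβ hγ hN0 hT hϑ0 h2ϑ hLc hLb 0).1
  have hRLm : Measurable (R LΨ) :=
    (pinnedChain_stronglyMeasurable_resolvent hω hl hβ.le hγ.le T T hLc.measurable lam').measurable
  have hRΨm : Measurable (R Ψ) :=
    (pinnedChain_stronglyMeasurable_resolvent hω hl hβ.le hγ.le T T hΨc.measurable lam').measurable
  set V : PhaseSpace N → ℝ := fun z => R LΨ z - (lam' * R Ψ z - Ψ z) with hV
  have hVm : Measurable V := hRLm.sub ((hRΨm.const_mul lam').sub hΨc.measurable)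
  have hW2 : Integrable (fun z => (lam' * R Ψ z - Ψ z) ^ 2) π :=
    (((hRΨ.1.const_mul (lam' ^ 2)).add hΨ2).const_mul 2).mono'
      (((hRΨm.const_mul lam').sub hΨc.measurable).pow_const 2).aestronglyMeasurable
      (Eventually.of_forall fun z => by
        rw [Real.norm_eq_abs, abs_of_nonneg (sq_nonneg _), Pi.add_apply]
        nlinarith [sq_nonneg (lam' * R Ψ z + Ψ z)])
  have hV2 : Integrable (fun z => V z ^ 2) π :=
    ((hRL.1.add hW2).const_mul 2).mono' (hVm.pow_const 2).aestronglyMeasurable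
      (Eventually.of_forall fun z => by
        rw [Real.norm_eq_abs, abs_of_nonneg (sq_nonneg _), Pi.add_apply]
        simp only [hV]
        nlinarith [sq_nonneg (R LΨ z + (lam' * R Ψ z - Ψ z))])
  have hVL : MemLp V 2 π := (memLp_two_iff_integrable_sq hVm.aestronglyMeasurable).2 hV2
  -- weak equation for `V`
  have hweak : ∀ G : PhaseSpace N → ℝ, ContDiff ℝ ∞ G → HasCompactSupport G →
      ∫ z, (lam' * G z - P.generator N T T (fun y : PhaseSpace N => G (y.1, -y.2)) (z.1, -z.2)) * V z ∂π = 0 := by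
    intro G hG hGc
    set A : PhaseSpace N → ℝ := fun z => lam' * G z - P.generator N T T (fun y : PhaseSpace N => G (y.1, -y.2)) (z.1, -z.2)
      with hA
    -- `A` is a bounded continuous compactly supported function
    have hΘc : Continuous (fun y : PhaseSpace N => ((y.1, -y.2) : PhaseSpace N)) := continuous_fst.prodMk continuous_snd.neg
    have hΘs : ContDiff ℝ ∞ (fun y : PhaseSpace N => ((y.1, -y.2) : PhaseSpace N)) := contDiff_fst.prodMk contDiff_snd.neg
    set Θh : PhaseSpace N ≃ₜ PhaseSpace N := (Homeomorph.refl (Fin N → ℝ)).prodCongr (Homeomorph.neg (Fin N → ℝ)) with hΘh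
    have hGΘ2 : ContDiff ℝ 2 (fun y : PhaseSpace N => G (y.1, -y.2)) := (hG.comp hΘs).of_le (by norm_cast)
    have hGΘc : HasCompactSupport (fun y : PhaseSpace N => G (y.1, -y.2)) := hGc.comp_homeomorph Θh
    have hLGc : Continuous (P.generator N T T (fun y : PhaseSpace N => G (y.1, -y.2))) := P.continuous_generator hU1 hV1 N T T hGΘ2
    have hLGs : HasCompactSupport (P.generator N T T (fun y : PhaseSpace N => G (y.1, -y.2))) :=
      P.hasCompactSupport_generator N T T hGΘ2 hGΘc
    have hAc : Continuous A := (continuous_const.mul hG.continuous).sub (hLGc.comp hΘc)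
    have hAs : HasCompactSupport A := (hGc.mul_left).sub (hLGs.comp_homeomorph Θh)
    obtain ⟨BA, hBA⟩ := hAc.bounded_above_of_compact_support hAs
    have hA2 : Integrable (fun z => A z ^ 2) π := integrable_sq_of_bounded hAc hBA
    have iARL : Integrable (fun z => A z * R LΨ z) π :=
      integrable_mul_of_integrable_sq hAc.aestronglyMeasurable hRLm.aestronglyMeasurable hA2 hRL.1
    have iARΨ : Integrable (fun z => A z * R Ψ z) π :=
      integrable_mul_of_integrable_sq hAc.aestronglyMeasurable hRΨm.aestronglyMeasurable hA2 hRΨ.1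
    have iAΨ : Integrable (fun z => A z * Ψ z) π :=
      integrable_mul_of_integrable_sq hAc.aestronglyMeasurable hΨc.aestronglyMeasurable hA2 hΨ2
    -- the three evaluations
    have e1 : ∫ z, A z * R LΨ z ∂π = ∫ z, G z * LΨ z ∂π :=
      pinnedChain_resolvent_adjoint_test hω hl hβ hγ hN hT hϑ0 h2ϑ hG hGc hLc hCL hLb hlam
    have e2 : ∫ z, A z * R Ψ z ∂π = ∫ z, G z * Ψ z ∂π :=
      pinnedChain_resolvent_adjoint_test hω hl hβ hγ hN hT hϑ0 h2ϑ hG hGc hΨc hCΨ hΨb hlam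
    have e3 : ∫ z, A z * Ψ z ∂π = lam' * (∫ z, G z * Ψ z ∂π) - ∫ z, G z * LΨ z ∂π := by
      have i1 : Integrable (fun z => lam' * (G z * Ψ z)) π :=
        ((hG.continuous.mul hΨc).integrable_of_hasCompactSupport hGc.mul_right).const_mul lam'
      have i2 : Integrable (fun z => P.generator N T T (fun y : PhaseSpace N => G (y.1, -y.2)) (z.1, -z.2) * Ψ z) π :=
        ((hLGc.comp hΘc).mul hΨc).integrable_of_hasCompactSupport ((hLGs.comp_homeomorph Θh).mul_right)
      rw [← pinnedChain_integral_adjGenerator_mul hT hG hGc hΨ, ← integral_const_mul,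
        ← integral_sub i1 i2]
      exact integral_congr_ae (Eventually.of_forall fun z => by simp only [hA]; ring)
    have hsplit : (fun z => A z * V z) = fun z => A z * R LΨ z - lam' * (A z * R Ψ z) + A z * Ψ z := by
      funext z; simp only [hV]; ring
    have i12 : Integrable (fun z => A z * R LΨ z - lam' * (A z * R Ψ z)) π := iARL.sub (iARΨ.const_mul lam')
    rw [hsplit, integral_add i12 iAΨ, integral_sub iARL (iARΨ.const_mul lam'), integral_const_mul, e1, e2, e3]
    ring
  have h0 := ae_eq_zero_of_weak_resolvent_adjoint hω hl hβ hγ hN hT hlam hVm hVL hweak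
  filter_upwards [h0] with z hz
  simp only [hV, Pi.zero_apply, sub_eq_zero] at hz
  exact hz

/-- **`μ_T(LΨ) = 0` for smooth nice `Ψ` with nice `LΨ`** (integrate the coboundary lemma against `μ_T`
and use `∫ R_λ f dμ_T = μ_T(f)/λ`). [folklore] -/
theorem pinnedChain_integral_generator_gibbsMeasure_eq_zero {ϑ : ℝ} (hϑ0 : 0 < ϑ) (h2ϑ : 2 * ϑ < 1 / T)
    {Ψ : PhaseSpace N → ℝ} (hΨ : ContDiff ℝ 2 Ψ) {CΨ CL : ℝ} (hCΨ : 0 ≤ CΨ) (hCL : 0 ≤ CL)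
    (hΨb : ∀ y, |Ψ y| ≤ CΨ * Real.exp (ϑ * (pinnedChain ω₂ lam β γ).hamiltonian N y))
    (hLb : ∀ y, |(pinnedChain ω₂ lam β γ).generator N T T Ψ y| ≤ CL * Real.exp (ϑ * (pinnedChain ω₂ lam β γ).hamiltonian N y)) :
    ∫ z, (pinnedChain ω₂ lam β γ).generator N T T Ψ z ∂((pinnedChain ω₂ lam β γ).gibbsMeasure N T) = 0 := by
  set P := pinnedChain ω₂ lam β γ with hP
  set π := P.gibbsMeasure N T with hπ
  have hN0 : 0 < N := by omega
  have hϑ1 : ϑ < 1 / T := by linarith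
  haveI : IsProbabilityMeasure π := pinnedChain_isProbabilityMeasure_gibbsMeasure hω hl hβ.le γ N hT
  have hU1 : ContDiff ℝ 1 P.U := pinnedChain_contDiff_U ω₂ lam β γ
  have hV1 : ContDiff ℝ 1 P.V := pinnedChain_contDiff_V ω₂ lam β γ
  have hLc : Continuous (P.generator N T T Ψ) := P.continuous_generator hU1 hV1 N T T hΨ
  have hcob := pinnedChain_resolvent_coboundary hω hl hβ hγ hN hT hϑ0 h2ϑ hΨ hCΨ hCL hΨb hLb one_pos
  have h1 := pinnedChain_integral_resolvent_gibbsMeasure hω hl hβ hγ hN hT hϑ0 h2ϑ hLc hCL hLb one_pos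
  have h2 := pinnedChain_integral_resolvent_gibbsMeasure hω hl hβ hγ hN hT hϑ0 h2ϑ hΨ.continuous hCΨ hΨb one_pos
  rw [integral_congr_ae hcob] at h1
  have hRΨ := pinnedChain_integral_sq_resolvent_le hω hl hβ hγ hN0 hT hϑ0 h2ϑ hΨ.continuous hCΨ hΨb one_pos
  have hRΨm : Measurable fun z => ∫ t in Ioi (0 : ℝ), Real.exp (-(1 * t)) *
      ∫ y, Ψ y ∂(P.transitionKernel N T T t.toNNReal z) :=
    (pinnedChain_stronglyMeasurable_resolvent hω hl hβ.le hγ.le T T hΨ.continuous.measurable 1).measurable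
  have iR : Integrable (fun z => ∫ t in Ioi (0 : ℝ), Real.exp (-(1 * t)) *
      ∫ y, Ψ y ∂(P.transitionKernel N T T t.toNNReal z)) π :=
    ((memLp_two_iff_integrable_sq hRΨm.aestronglyMeasurable).2 hRΨ.1).integrable one_le_two
  have iΨ : Integrable Ψ π :=
    integrable_of_abs_le_exp (pinnedChain_integrable_exp_mul_hamiltonian_gibbsMeasure hω hl hβ.le γ N hT hϑ1) hΨ.continuous hΨb
  rw [integral_sub (iR.const_mul 1) iΨ, integral_const_mul, h2] at h1
  simp only [inv_one, one_mul] at h1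
  linarith

end Pinned

end Summit.AtomisticToContinuum.FouriersLaw.Theorems.OddSectorIrreversibility

end
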